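import Literature.Geometry.Kaehler.AnalyticSet

/-!
# Irreducible components of analytic subsets of complex manifolds (trunk `Kaehler`)

Faithful vendoring of E. M. Chirka, *Complex Analytic Sets* (Kluwer 1989), Ch. 1 §5.4
"Irreducible components", pp. 56–57 [Chirka1989], on top of
`Literature/Geometry/Kaehler/AnalyticSet.lean` (`Literature.Geometry.Kaehler.IsAnalyticSet`, `Literature.Geometry.Kaehler.regularLocus`,
`Literature.Geometry.Kaehler.IsIrreducibleAnalyticSet`).

* `Literature.IsIrreducibleComponent I Z Z'` — the **definition** (§5.4, p. 56): `Z'` is an irreducible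
  analytic subset of `M` contained in `Z` and maximal with this property.
* Named facts (`def … : Prop`, hypotheses `[FiniteDimensional ℂ E] [IsManifold I 1 M]
  [I.Boundaryless]` bound inside, `I` and `M` explicit — same conventions as the deep facts of
  `AnalyticSet.lean`):
  - `Literature.Geometry.Kaehler.IsAnalyticSet.isIrreducibleComponent_closure_connectedComponentIn` (§5.4 Lemma, p. 56):
    the closure of a connected component of `reg Z` is an irreducible component of `Z`;
  - `Literature.Geometry.Kaehler.IsIrreducibleComponent.exists_eq_closure_connectedComponentIn` (§5.4 Thm. (1), p. 57):
    every irreducible component has this form;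
  - `Literature.Geometry.Kaehler.IsAnalyticSet.eq_iUnion_closure_connectedComponentIn` (§5.4 Thm. (2), p. 57):
    `Z` is the union of the closures of the connected components of `reg Z`;
  - `Literature.Geometry.Kaehler.IsAnalyticSet.finite_isIrreducibleComponent_inter_compact` (§5.4 Thm. (3), p. 57):
    the irreducible components form a locally finite family (finitely many meet any compact).
* Proved corollary `Literature.Geometry.Kaehler.IsAnalyticSet.exists_isIrreducibleComponent_of_mem`: every point of an
  analytic subset lies on one of its irreducible components (from the Lemma and Thm. (2)).

## Why this file exists (discrepancy note)

The older named fact `Literature.Geometry.Kaehler.IsAnalyticSet.exists_isIrreducibleAnalyticSet_subset_of_mem`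
(in `AnalyticSet.lean`, also citing [Chirka1989, §5.4 Thm.]) only asks for *some* irreducible
analytic `Z' ⊆ Z` through `x`; it is discharged there by the singleton `Z' := {x}` and hence
carries none of the strength of the decomposition theorem. The statement intended by its
docstring ("`x` lies on one of the irreducible components of `Z`") is
`Literature.Geometry.Kaehler.IsAnalyticSet.exists_isIrreducibleComponent_of_mem` below, whose conclusion uses the
maximality predicate `Literature.Geometry.Kaehler.IsIrreducibleComponent`.

## Conventions carried over

Chirka's analytic sets are only locally closed and "irreducible component" uses closures *in `A`*;
here `IsAnalyticSet I Z` forces `Z` closed in `M` (`Literature.Geometry.Kaehler.IsAnalyticSet.isClosed`), so closures are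
taken in `M`. Chirka's "reducible" (`A = A₁ ∪ A₂` with `Aᵢ ≠ A` analytic) is equivalent, for
analytic `A`, to the negation of the covering form used in `Literature.Geometry.Kaehler.IsIrreducibleAnalyticSet`
(intersect `A₁, A₂` with `A`). Connected components of `reg Z` (a subspace of `M`) are spelled
`connectedComponentIn (regularLocus I Z) y`, `y ∈ regularLocus I Z`.

Usage note: to pass a named fact `h : <Fact> I M` (whose body starts with `∀ [·]` instance
binders) on to another lemma as a term, write `@h` (see
`IsAnalyticSet.exists_isIrreducibleAnalyticSet_subset_of_mem_of_component`); applying it to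
explicit arguments (`h hZ hy`) needs no annotation.

## References

* E. M. Chirka, *Complex Analytic Sets*, Kluwer 1989, Ch. 1 §5.3–5.4, pp. 54–57 [Chirka1989].
* R. C. Gunning, H. Rossi, *Analytic Functions of Several Complex Variables* (1965), Ch. II §E
  Thm. 15 (local version via germs).
-/

open scoped Manifold ContDiff Topology
open Set

namespace Literature.Geometry.Kaehler

variable {E : Type*} [NormedAddCommGroup E] [NormedSpace ℂ E]
  {H : Type*} [TopologicalSpace H] (I : ModelWithCorners ℂ E H)
  {M : Type*} [TopologicalSpace M] [ChartedSpace H M]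

/-! ### Definition -/

/-- `IsIrreducibleComponent I Z Z'`: `Z'` is an *irreducible component* of the subset `Z ⊆ M`,
i.e. `Z'` is an irreducible analytic subset of `M` (`IsIrreducibleAnalyticSet I Z'`) contained
in `Z`, and it is maximal among such: every irreducible analytic `Z''` with `Z' ⊆ Z'' ⊆ Z`
equals `Z'` (Chirka: "every analytic subset `A'' ⊂ A` such that `A'' ≠ A'` and `A' ⊂ A''` is
reducible"). [cite: Chirka1989, §5.4 Def., p. 56] -/
def IsIrreducibleComponent (Z Z' : Set M) : Prop :=
  IsIrreducibleAnalyticSet I Z' ∧ Z' ⊆ Z ∧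
    ∀ Z'' : Set M, IsIrreducibleAnalyticSet I Z'' → Z' ⊆ Z'' → Z'' ⊆ Z → Z'' = Z'

variable {I}

/-- An irreducible component is an irreducible analytic subset. [folklore] -/
theorem IsIrreducibleComponent.isIrreducibleAnalyticSet {Z Z' : Set M}
    (h : IsIrreducibleComponent I Z Z') : IsIrreducibleAnalyticSet I Z' := h.1

/-- An irreducible component of `Z` is contained in `Z`. [folklore] -/
theorem IsIrreducibleComponent.subset {Z Z' : Set M} (h : IsIrreducibleComponent I Z Z') :
    Z' ⊆ Z := h.2.1

/-- An irreducible component is nonempty. [folklore] -/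
theorem IsIrreducibleComponent.nonempty {Z Z' : Set M} (h : IsIrreducibleComponent I Z Z') :
    Z'.Nonempty := h.1.2.1

/-- Maximality of an irreducible component among irreducible analytic subsets of `Z`.
[cite: Chirka1989, §5.4 Def., p. 56] -/
theorem IsIrreducibleComponent.eq_of_subset {Z Z' Z'' : Set M} (h : IsIrreducibleComponent I Z Z')
    (h'' : IsIrreducibleAnalyticSet I Z'') (h₁ : Z' ⊆ Z'') (h₂ : Z'' ⊆ Z) : Z'' = Z' :=
  h.2.2 Z'' h'' h₁ h₂

/-- An irreducible analytic set is its own (unique) irreducible component. [folklore] -/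
theorem IsIrreducibleAnalyticSet.isIrreducibleComponent_self {Z : Set M}
    (h : IsIrreducibleAnalyticSet I Z) : IsIrreducibleComponent I Z Z :=
  ⟨h, Subset.rfl, fun _ _ h₁ h₂ => Subset.antisymm h₂ h₁⟩

/-- The irreducible components of an irreducible analytic set `Z` are exactly `Z` itself.
[folklore] -/
theorem IsIrreducibleAnalyticSet.isIrreducibleComponent_iff {Z Z' : Set M}
    (h : IsIrreducibleAnalyticSet I Z) : IsIrreducibleComponent I Z Z' ↔ Z' = Z :=
  ⟨fun h' => (h'.eq_of_subset h h'.subset Subset.rfl).symm,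
    fun e => e ▸ h.isIrreducibleComponent_self⟩

/-! ### The decomposition theorem (named facts) -/

section Deep

variable (I) (M)

/-- **Chirka §5.4 Lemma.** Let `Z` be an analytic subset of a complex manifold and `S` a
connected component of `reg Z`. Then the closure `S̄` is an irreducible component of `Z`.
[cite: Chirka1989, §5.4 Lemma, p. 56] -/
def IsAnalyticSet.isIrreducibleComponent_closure_connectedComponentIn : Prop :=
  ∀ [FiniteDimensional ℂ E] [IsManifold I 1 M] [I.Boundaryless] ⦃Z : Set M⦄,
    IsAnalyticSet I Z → ∀ ⦃y : M⦄, y ∈ regularLocus I Z →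
      IsIrreducibleComponent I Z (closure (connectedComponentIn (regularLocus I Z) y))

/-- **Chirka §5.4 Theorem, part (1).** Every irreducible component of an analytic subset `Z` of a
complex manifold has the form `S̄`, where `S` is a connected component of `reg Z`.
[cite: Chirka1989, §5.4 Thm. (1), p. 57] -/
def IsIrreducibleComponent.exists_eq_closure_connectedComponentIn : Prop :=
  ∀ [FiniteDimensional ℂ E] [IsManifold I 1 M] [I.Boundaryless] ⦃Z Z' : Set M⦄,
    IsAnalyticSet I Z → IsIrreducibleComponent I Z Z' →
      ∃ y ∈ regularLocus I Z, Z' = closure (connectedComponentIn (regularLocus I Z) y)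

/-- **Chirka §5.4 Theorem, part (2).** If `reg Z = ⋃ⱼ Sⱼ` is the decomposition of the regular
locus of an analytic subset `Z` of a complex manifold into connected components, then
`Z = ⋃ⱼ S̄ⱼ` (and, by the Lemma and part (1), this is the decomposition of `Z` into irreducible
components). The components are indexed here by their points `y ∈ reg Z`.
[cite: Chirka1989, §5.4 Thm. (2), p. 57] -/
def IsAnalyticSet.eq_iUnion_closure_connectedComponentIn : Prop :=
  ∀ [FiniteDimensional ℂ E] [IsManifold I 1 M] [I.Boundaryless] ⦃Z : Set M⦄,
    IsAnalyticSet I Z →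
      Z = ⋃ y ∈ regularLocus I Z, closure (connectedComponentIn (regularLocus I Z) y)

/-- **Chirka §5.4 Theorem, part (3).** The decomposition of an analytic subset `Z` of a complex
manifold into irreducible components is locally finite: every compact `K ⊆ M` meets only
finitely many irreducible components of `Z`. [cite: Chirka1989, §5.4 Thm. (3), p. 57] -/
def IsAnalyticSet.finite_isIrreducibleComponent_inter_compact : Prop :=
  ∀ [FiniteDimensional ℂ E] [IsManifold I 1 M] [I.Boundaryless] ⦃Z : Set M⦄,
    IsAnalyticSet I Z → ∀ ⦃K : Set M⦄, IsCompact K →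
      {Z' : Set M | IsIrreducibleComponent I Z Z' ∧ (K ∩ Z').Nonempty}.Finite

variable {I} {M}

/-- **Every point of an analytic subset lies on one of its irreducible components** — the
statement intended by `Literature.Geometry.Kaehler.IsAnalyticSet.exists_isIrreducibleAnalyticSet_subset_of_mem`, with
the maximality that makes it non-trivial. Derived from [Chirka1989, §5.4 Thm. (2)] (the point
lies on some `S̄`) and [Chirka1989, §5.4 Lemma] (`S̄` is an irreducible component).
[cite: Chirka1989, §5.4 Thm., p. 57] -/
theorem IsAnalyticSet.exists_isIrreducibleComponent_of_mem
    (h₂ : IsAnalyticSet.eq_iUnion_closure_connectedComponentIn I M)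
    (hL : IsAnalyticSet.isIrreducibleComponent_closure_connectedComponentIn I M)
    [FiniteDimensional ℂ E] [IsManifold I 1 M] [I.Boundaryless] {Z : Set M}
    (hZ : IsAnalyticSet I Z) {x : M} (hx : x ∈ Z) :
    ∃ Z' : Set M, IsIrreducibleComponent I Z Z' ∧ x ∈ Z' := by
  have hx' : x ∈ ⋃ y ∈ regularLocus I Z, closure (connectedComponentIn (regularLocus I Z) y) :=
    h₂ hZ ▸ hx
  simp only [mem_iUnion, exists_prop] at hx'
  obtain ⟨y, hy, hxy⟩ := hx'
  exact ⟨_, hL hZ hy, hxy⟩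

/-- In particular (forgetting maximality) the two §5.4 facts imply the older, weaker named fact
`Literature.Geometry.Kaehler.IsAnalyticSet.exists_isIrreducibleAnalyticSet_subset_of_mem`. [folklore] -/
theorem IsAnalyticSet.exists_isIrreducibleAnalyticSet_subset_of_mem_of_component
    (h₂ : IsAnalyticSet.eq_iUnion_closure_connectedComponentIn I M)
    (hL : IsAnalyticSet.isIrreducibleComponent_closure_connectedComponentIn I M) :
    IsAnalyticSet.exists_isIrreducibleAnalyticSet_subset_of_mem I M := by
  intro _ _ _ Z hZ x hx
  obtain ⟨Z', hZ', hxZ'⟩ :=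
    IsAnalyticSet.exists_isIrreducibleComponent_of_mem @h₂ @hL hZ hx
  exact ⟨Z', hZ'.isIrreducibleAnalyticSet, hZ'.subset, hxZ'⟩

end Deep

end Literature.Geometry.Kaehler
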